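import Summits.BirchSwinnertonDyer.Rank1Residual.F1Sign2.AdditiveSharpChi8AtTwo
import Summits.BirchSwinnertonDyer.Rank1Residual.F1Sign2.SupersingularTowerNormIndexAtTwo
import Literature.NumberTheory.EllipticCurves.Tamagawa
import HarnessLib

/-!
# Cell `bsd-f1-sign2` — IMC lens (seat `-imc`, PLANNER-OF-RECORD) g6, MEMO-imc §10.54 / §10.56: **IMC-MTF2**, the `𝔽₂`-Fitting shadow of
# Kurihara's finite-layer pair `(θ_n, ν θ_{n-1})` at `p = 2` — `MazurTateFittingShadowAtTwo` (STRONG) / `MazurTateFittingShadowAtTwoLe` (WEAK)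

STATEMENTS ONLY: two helper defs WITH BODIES (`twoAdicUnitOrd`, `mtPairShadow`), two `@[conjecture] def`s (conjecture-grade candidates, nothing
asserted), the PROVED bookkeeping `mazurTateFittingShadowAtTwo_le_of_eq` (STRONG ⇒ WEAK on the Tam-odd locus) and two `decide`/`simp` sanity examples;
no `instance`, no `notation`, no named Literature fact, no `sorry`.

TYPER FILING (seat `bsd-f1-sign2-ty` g7; CANDIDATES.md row IMC-MTF2; -imc g6 CANDIDATES-delta 2026-08-28T06:40:31Z «file statement-only AFTER REF1's
A1–A6/BC7 pass; target `F1Sign2/MazurTateFittingShadowAtTwo.lean`; docstring = §10.54 (b) + the KO/KK/Pollack/Sprung locators of §10.54 (a)»): bodies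
VERBATIM from `HOME/MEMO-imc-data/dimc16/SketchG6MTF2.lean` 50578df4d40e394c (farm rc 0 · 0 warnings · 0 sorries) — builder `tools/mk_mtf2.py` applies: this
header; REF1-AUDIT §78's docstring riders r1 (`W(ℚ_n)[2] = 0` one-liner), r2 (Kim–Kurihara Conj 1.6 is stated for ODD p; Rem 1.10 and KO Rem 0.2 (3)
quoted; the normalisation `C ϖ * mazurTateElement f 2 n = −θ^{KO}_{ℚ_n}(W)`), r3 (the intended discharge of the 2-integrality hypothesis `hint`), r4 (CM /
Tam-even rows: equality RECORDED so far, not claimed); bib key `KimKurihara2021` ADDED to `references.bib` (IMRN 2021 no. 14 = arXiv:1804.00418; REF1: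
«bib keys to be checked by -ty»), `KuriharaOtsuki2006` / `MazurTate1987` / `Pollack2005` / `Sprung2017` checked present.
REF1-AUDIT-v1 §78 (2026-08-28T07:02:19Z; evidence `HOME/REF1-data/b78/`: Probe_MTF2.lean 9fbca7f671752c98 = sketch body verbatim + 12 audit examples, rc 0 ·
0 sorry · 0 warn; mtf2_checks.py/.out): **STRONG `MazurTateFittingShadowAtTwo` SURVIVES conjecture-grade, CLEARED for filing as typed; WEAK
`MazurTateFittingShadowAtTwoLe` SURVIVES conjecture-grade, CLEARED; `mazurTateFittingShadowAtTwo_le_of_eq` correct.** A1 e8 (proved): the k-window encoding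
`∀ k ≤ 2^n, (rk₂ ≥ k ↔ k ≤ m_n)` ⟺ `min(rk₂, 2^n) = m_n` (WEAK ⟺ ≤), given `m_n ≤ 2^n` (e7) and `nRankAtLeast.mono` (e9); k = 0 harmless (e1). A2: tree
`mazurTateElement f 2 n = Σ_s 2·[5^s/2^{n+2}]⁺_f (1+T)^s` (`Sprung2017.mazurTateElement_two_eq`, e10; θ_0 = 2[1/4]⁺, e11) and KO 2006 §1.2 [corpus:
doi-10-4310-pamq-2006-v2-n2-a8 p5 L5–17, L37–40] ⇒ `C ϖ * mazurTateElement f 2 n = −θ^{KO}_{ℚ_n}(W)` exactly (Δ-doubling on both sides; the sign is a unit),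
so `a_n`, `m_n` are KO's / KK's objects — no stray factor 2; in the corner a₂ = ±2, 2 ∤ L/Ω, 2 ∤ Tam STRONG is PRINT (KO Thm 0.1 ⇒ Sel^∨/2 ≅ 𝔽₂[T]/T^{m_n};
D-imc-16 S0 24/24 = calibration). A3 junk documented & harmless (e2 `twoAdicUnitOrd 0 = ⊤`; e3 non-integral coefficients ignored, junk only off `hint`; e4
`a(C 2) = ⊤`; e5 `a(C 2 + X^3) = 3`; e6 n = 1 reads θ_0 as intended). A4 carriers = §35/§41 reading (`selmerLayer` = Sel_{2^∞}(W/K_n) discrete; `GoodSS` = good ∧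
2 ∣ a₂; `IsCyclotomic` redundant-harmless). A5 pin: ϖ ≠ 0 forced (`plusPeriod_pos_holds`, `realPeriodRat_pos_holds`) so no θ ≡ 0 collapse; `hint`
SATISFIABLE on all samples (μ(θ_n) over MTF2-PRED-v1 5 109 rows × 9 layers ≥ 0, negative: 0). A6: `¬HasCM` / Tam-odd conservative (CM 9/9 EQ, S4 36/36 EQ
recorded, not claimed). r5 (for -imc's memo): KO's distribution relation with a₂ even gives the LAW `a_{n+1} = 2^{n−1} + a_{n−1}` when `a_{n−1} < 2^{n−1}`
(MTF2-PRED-v1: 33 576/33 576 transitions), so `m_n` is automatically non-decreasing and the shadow's free data are `(a_0, a_1)` + the μ > 0 layers; next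
falsifier = one n = 4 cell (degree 16) on a small-N S1 curve (19a1: s_4 = 5 predicted). Placement reading (REF1; = REF2 v18 §5 since: STATEMENT VARIANT-AT-2, theorem mod 2 in the KO corner, no printed counterexample to the Fitting equality): no
printed computation / prediction of dim Sel₂(E/ℚ_n) up the ℤ₂-tower at p = 2 outside KO's corner found ⇒ conjecture-grade CANDIDATE with pre-registered
confirmed cells beyond print; beyond-print THEOREM: no. PARTITION none.
CENSUS / BC5 (-imc g6; kit tag bsd-frontier-data): prediction table `HOME/MEMO-imc-data/dimc16/MTF2-PRED-v1.tsv` a846fb242bf6a226 (5 109 ss-at-2 rows; two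
θ-engines overlap on 416 curves with 0 μ/λ mismatches); cheapest falsifier T0 (monotonicity `s_n ≥ s_0` vs WEAK, `T0-result.json`): **0/3 366 violations**
(1 184 rows with s_0 ≥ 2 require a_1 = ∞ — met 1 184/1 184; 1 521 rows TIGHT); deciding test **D-imc-16 ENGINE A** (job:j301038, rc 0, wall 525 s;
`j301038-stream/D16A-TABLE.tsv` 6f5167d69313d1e9, pre-registered P18 README 10204d8fcce75391 before any output): `min(s_n, 2^n) = m_n` for n = 1, 2, 3 on
**309/309 layer-cells of 103 curves** (0 LT, 0 GT; 412/412 precision-level agreements; 0 non-monotone towers) — S0 basic a₂ = ±2 (KO, PRINT, calibration)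
24/24 (0,1,1,3) ×8; **S1 basic a₂ = 0 (beyond print) 90/90 (0,1,1,5) ×30**; S2 rank 1/2 Tam-odd 102/102; S3 rank 0 Tam-odd Ш_an = 16/4 48/48; S4 Tam-even
(typed WEAK only) 36/36 all equalities; engine B (j301039) pending at filing. KILL RULE (P18): one Tam-odd non-CM row with A = B and `min(s_n,2^n) ≠ m_n`
kills STRONG as typed; any row with `min(s_n,2^n) > m_n` kills WEAK. WHY NOVEL (-imc §10.54 (f)): no printed statement computes or predicts the 2-Selmer ranks
up the cyclotomic ℤ₂-tower of a non-CM curve supersingular at 2 outside the Kurihara–Otsuki corner; for a₂ = 0, rank ≥ 1, Ш[2] ≠ 0 the finite-layer pair at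
2 is a conjecture its own authors flag as possibly failing at p = 2 (KK Rem 1.10), and MTF2 turns it into an integer law two 2-descent engines decide.
BARRIER: `Literature/Barriers/BirchSwinnertonDyer/IwasawaTheoryAtTwo.lean` `SignedIwasawaTheoryAtTwoBarrier` is a literature GAP, not a no-go — MTF2 sits
inside the gap it names (no ± Coleman maps used; `Kobayashi2003`'s `[Fact (p ≠ 2)]` not touched).
PARTITION: none moved; beyond-print theorem: no. bears_on: the cell's search question on the SUPERSINGULAR side («what is the ± object at 2?» — finite-layer
answer: the pair (θ_n, ν θ_{n−1})); refines -desc's tower floor DESC-T; no registered statement item consumes these rows at filing.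

Planner's summary (verbatim): Cell `bsd-f1-sign2` — IMC lens (seat `-imc`) g6, MEMO-imc §10.54: **IMC-MTF2**, the `𝔽₂`-Fitting shadow of
Kurihara's finite-layer pair `(θ_n, ν θ_{n-1})` at `p = 2` (SKETCH — statement only, for `-ty` / `-ref1`)

For `E/ℚ` non-CM with good SUPERSINGULAR reduction at `2` (`a₂ ∈ {0, ±2}`), `ℚ_n` the `n`-th layer of the
cyclotomic `ℤ₂`-extension, `θ_n ∈ ℤ₂[Gal(ℚ_n/ℚ)] = ℤ₂[T]/((1+T)^{2^n} − 1)` the Mazur–Tate element in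
Kurihara's normalisation (BSD real period; tree: `C ϖ * mazurTateElement f 2 n` with the period pin
`ϖ · Ω(W) = Ω⁺_f` of AN-1), put `a_n := ord_T (θ_n mod 2) ∈ {0,…,2^n − 1} ∪ {∞}` (`= λ(θ_n)` if `μ(θ_n) = 0`,
`∞` otherwise) and `m_n := min(2^n, a_n, 2^{n−1} + a_{n−1})`. The candidate:

* STRONG (`Tam(E)` odd):  `min(s_n, 2^n) = m_n` for every `n ≥ 1`, `s_n := dim_{𝔽₂} Sel₂(E/ℚ_n)`
  (= the `2`-rank of `Sel_{2^∞}(E/ℚ_n)`, since `E(ℚ_n)[2] = 0` for `E` supersingular at `2`);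
* WEAK (all `E`):  `min(s_n, 2^n) ≤ m_n`.

DERIVATION (exact algebra): Kurihara's conjecture `Fitt_{ℤ₂[G_n]} Sel(ℚ_n, E[2^∞])^∨ = (θ_n, ν_{n−1,n} θ_{n−1})`
(Kim–Kurihara arXiv:1804.00418 = IMRN 2021 Conj. 1.6 — stated there for good reduction at an ODD prime `p`, `E(ℚ)[p] = 0`,
`p ∤ Tam(E)` (p. 5 L48–52; REF1 §78 r2 corrects -imc's «stated for all good p»); at `p = 2` the corresponding statement is proved ONLY for `a₂ = ±2`,
`ord₂(L(E,1)/Ω) = 0 = ord₂ Tam` by Kurihara–Otsuki 2006 Thm 0.1, and KO Rem 0.2 (3) (p. 3 L8–22) warns for `a₂ = 0` that «2 ∤ L(E,1)/Ω_E is not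
sufficient to determine (g(T)) … the structures of the Selmer groups over ℚ_n, n ≥ 3, are different» (X₀(19) vs X₀(27): a statement about the
ℤ₂[G_n]-STRUCTURE, compatible with the 𝔽₂-shadow below — 19a1: s = (0,1,1,5) = m observed)) + base change of Fitting ideals to
`𝔽₂[G_n] = 𝔽₂[T]/(T^{2^n})` (`ν ↦ T^{2^{n−1}}`) + `Fitt_{𝔽₂[T]/T^{2^n}}(M) = (T^{min(len M, 2^n)})`.
NOT IN PRINT outside the KO corner: Kim–Kurihara Rem. 1.10 «For the case of p=2, Conjecture 1.6 may not hold»;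
Pollack 2005 (arXiv:math/0407393) Thm 1.1 odd `p`, Rem 1.2; Sprung 2017 p. 7 («unknown cases (in which p=2)»).
BC5 WITNESS: prediction table `HOME/MEMO-imc-data/dimc16/MTF2-PRED-v1.tsv` (5 109 ss rows), falsifier T0 vs the
census 0/3 366 violations (monotonicity `s_n ≥ s_0`), deciding two-engine tower computation D-imc-16
(kit j301038 / j301039, predictions pre-registered P18).
-/

set_option autoImplicit false

noncomputable section

open scoped Classical MatrixGroups ModularForm NumberField

open CongruenceSubgroup Polynomial WeierstrassCurve Literature.NumberTheory.EllipticCurves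
  Literature.NumberTheory.EllipticCurves.ModularForms
  Literature.NumberTheory.EllipticCurves.Rank1Residual ZpExtension

open Literature.Barriers.BirchSwinnertonDyer (nRankAtLeast)

namespace Summit.BirchSwinnertonDyer.Rank1Residual.F1Sign2

/-- `a(P) := ord_T (P mod 2) ∈ ℕ∞` for a `2`-integral `P ∈ ℚ[X]`: the least index of a coefficient that is a
`2`-adic unit (`⊤` if every coefficient is `0` or divisible by `2`, i.e. `μ(P) ≥ 1` or `P = 0`). -/
def twoAdicUnitOrd (P : ℚ[X]) : ℕ∞ :=
  sInf ((fun i : ℕ ↦ (i : ℕ∞)) '' {i : ℕ | P.coeff i ≠ 0 ∧ padicValRat 2 (P.coeff i) = 0})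

/-- `m_n := min(2^n, a_n, 2^{n−1} + a_{n−1})`, the `T`-adic order of the image of the pair
`(θ_n, ν_{n−1,n} θ_{n−1})` in `𝔽₂[T]/(T^{2^n})` (`ν_{n−1,n} ≡ T^{2^{n−1}}` mod `2`), capped at `2^n`. -/
def mtPairShadow (θ : ℕ → ℚ[X]) (n : ℕ) : ℕ∞ :=
  min ((2 ^ n : ℕ) : ℕ∞) (min (twoAdicUnitOrd (θ n)) (((2 ^ (n - 1) : ℕ) : ℕ∞) + twoAdicUnitOrd (θ (n - 1))))

/-- **IMC-MTF2 (STRONG form, `Tam` odd) `MazurTateFittingShadowAtTwo`** — candidate, conjecture-grade.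
For `W/ℚ` globally minimal, non-CM, good supersingular at `2`, with newform `f`, period pin `ϖ·Ω(W) = Ω⁺_f`,
`θ_n := ϖ·θ_n(f)` `2`-integral (known: Manin constant odd as `E[2]` is irreducible — kept as a hypothesis), and
`Tam(W)` odd: for every `n ≥ 1` and `k ≤ 2^n`, `Sel_{2^∞}(W/ℚ_n)` has `2`-rank `≥ k` iff `k ≤ m_n`; i.e.
`min(dim_{𝔽₂} Sel₂(W/ℚ_n), 2^n) = m_n`. In print only for `a₂ = ±2 ∧ 2 ∤ L(W,1)/Ω` (KO 2006 Thm 0.1, `s_n = q_n`).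
RIDERS (REF1-AUDIT §78, docstring-level): (r1) the row speaks of the `2`-rank of `Sel_{2^∞}(W/ℚ_n)` (`nRankAtLeast … 2 k`); this equals
`dim_{𝔽₂} Sel₂(W/ℚ_n) = s_n` because `W(ℚ_n)[2] = 0`: for a minimal model with good supersingular reduction at `2`, `ã₁ = 0`, `ã₃ ≠ 0`, so the Newton
polygon of `[2](t) = 2t − a₁t² − 2a₂t³ + (a₁a₂ − 7a₃)t⁴ + …` from `(1,1)` to `(4,0)` is one segment of slope `−1/3` — the non-zero `2`-torsion points have
valuation `1/3`, hence none is rational over any `2`-power extension of `ℚ₂`, in particular over `ℚ_{n,v}`. (r2) NORMALISATION: the tree's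
`mazurTateElement f 2 n = Σ_{s mod 2^n} C(2·[5^s/2^{n+2}]⁺_f)(X+1)^s` (`Sprung2017.mazurTateElement_two_eq`; the Δ = {±1} doubling built in) and KO 2006 §1.2
(`[a/b] := Re(2πi∫)/Ω_E`, `Ω_E` = BSD period = the tree's `plusPeriod` convention, `θ_{ℚ_n} := res θ_{2^{n+2}} = Σ_s 2[5^s/2^{n+2}]γ^s`) give, with the AN-1
pin `ϖ·Ω(W) = Ω⁺_f`, `C ϖ * mazurTateElement f 2 n = −θ^{KO}_{ℚ_n}(W)` coefficientwise (`γ ↔ 1+T`; the sign is a unit), so `a_n`, `m_n` are exactly KO's /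
Kim–Kurihara's objects and no factor `2` hides; Kim–Kurihara Conj 1.6 is stated for ODD `p` (Rem 1.10 verbatim: «For the case of p=2, Conjecture 1.6 may
not hold. See [pollack-algebraic] and [kurihara-otsuki]»), so this row transposes its `𝔽₂`-shadow to `p = 2` where print declines to conjecture — hence
`@[conjecture]`, candidate. (r3) `hint` (2-integrality of `ϖ·θ_n(f)` = of KO's `θ_{ℚ_n}`) is a dischargeable printed fact kept as a hypothesis: `2[r]_W ∈
ℤ_{(2)}` from `re Λ_W = ℤΩ_W/2`, `E(ℚ)[2] = 0`, and the Manin constant being odd for odd `N` (Abbes–Ullmo 1996; Česnavičius 2018) — the intended discharge;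
it is SATISFIABLE on every sample (μ(θ_n) ≥ 0 on 5 109 rows × 9 layers). (r4) `¬ W.HasCM` and `Odd W.tamagawaProduct` are CONSERVATIVE: CM rows (9/9) and
Tam-even rows (D-imc-16 S4 36/36) satisfy the EQUALITY so far — recorded, NOT claimed. CENSUS: T0 0/3 366; D-imc-16 engine A 309/309 layer-cells EQ
(module docstring). [cite: KuriharaOtsuki2006, Thm. 0.1, Rem. 0.2 (3), §1.2] [cite: KimKurihara2021, Conj. 1.6 (odd p), Rem. 1.10]
[cite: Pollack2005, Thm. 1.1 (odd p), Rem. 1.2] [cite: Sprung2017, p. 7 («unknown cases (in which p = 2)»)] [cite: AbbesUllmo1996, (Manin constant; r3)]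
[cite: Cesnavicius2018, (Manin constant; r3)] -/
@[conjecture] def MazurTateFittingShadowAtTwo : Prop :=
  ∀ {N : ℕ} [NeZero N] (f : CuspForm (Gamma0 N) 2) (W : WeierstrassCurve ℚ) [W.IsElliptic] [W.IsGloballyMinimal]
    (ϖ : ℚ), IsNewformOf W f → GoodSS W 2 → ¬ W.HasCM →
    (ϖ : ℝ) * W.realPeriodRat = plusPeriod f →
    (∀ n i : ℕ, 0 ≤ padicValRat 2 ((C ϖ * mazurTateElement f 2 n).coeff i)) →
    Odd W.tamagawaProduct →
    ∀ (κ : ZpExtension ℚ 2), κ.IsCyclotomic →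
    ∀ n k : ℕ, 1 ≤ n → k ≤ 2 ^ n →
      (nRankAtLeast (↥(W.selmerLayer κ n)) 2 k ↔
        (k : ℕ∞) ≤ mtPairShadow (fun m ↦ C ϖ * mazurTateElement f 2 m) n)

/-- **IMC-MTF2 (WEAK form, no Tamagawa hypothesis) `MazurTateFittingShadowAtTwoLe`** — candidate: the
`2`-rank of `Sel_{2^∞}(W/ℚ_n)` capped at `2^n` is at most `m_n` (`= 𝔽₂`-shadow of the Mazur–Tate "weak main
conjecture" `θ_n ∈ Fitt` together with its `ν`-companion; Kim–Kurihara Thm 1.14 proves the un-capped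
`ℤ_p`-version for ODD `p` only; at `p = 2` nothing in print outside KO's corner — `@[conjecture]`, candidate). Riders r1–r3 of the STRONG row apply
verbatim; no Tamagawa / CM hypothesis here (REF1 §78 A6: D-imc-16 S4 Tam-even 36/36 and CM 9/9 satisfy even the equality so far — recorded, not claimed).
KILL RULE: any row with `min(s_n, 2^n) > m_n`. [cite: KimKurihara2021, Thm. 1.14 (odd p), Rem. 1.10] [cite: MazurTate1987, Conj. 3]
[cite: KuriharaOtsuki2006, Thm. 0.1] -/
@[conjecture] def MazurTateFittingShadowAtTwoLe : Prop :=
  ∀ {N : ℕ} [NeZero N] (f : CuspForm (Gamma0 N) 2) (W : WeierstrassCurve ℚ) [W.IsElliptic] [W.IsGloballyMinimal]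
    (ϖ : ℚ), IsNewformOf W f → GoodSS W 2 → ¬ W.HasCM →
    (ϖ : ℝ) * W.realPeriodRat = plusPeriod f →
    (∀ n i : ℕ, 0 ≤ padicValRat 2 ((C ϖ * mazurTateElement f 2 n).coeff i)) →
    ∀ (κ : ZpExtension ℚ 2), κ.IsCyclotomic →
    ∀ n k : ℕ, 1 ≤ n → k ≤ 2 ^ n →
      nRankAtLeast (↥(W.selmerLayer κ n)) 2 k →
        (k : ℕ∞) ≤ mtPairShadow (fun m ↦ C ϖ * mazurTateElement f 2 m) n

/-- STRONG ⇒ WEAK on the `Tam`-odd locus (bookkeeping sanity; the general WEAK form is a separate claim). -/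
theorem mazurTateFittingShadowAtTwo_le_of_eq (h : MazurTateFittingShadowAtTwo)
    {N : ℕ} [NeZero N] (f : CuspForm (Gamma0 N) 2) (W : WeierstrassCurve ℚ) [W.IsElliptic] [W.IsGloballyMinimal]
    (ϖ : ℚ) (hf : IsNewformOf W f) (hss : GoodSS W 2) (hcm : ¬ W.HasCM)
    (hpin : (ϖ : ℝ) * W.realPeriodRat = plusPeriod f)
    (hint : ∀ n i : ℕ, 0 ≤ padicValRat 2 ((C ϖ * mazurTateElement f 2 n).coeff i))
    (htam : Odd W.tamagawaProduct) (κ : ZpExtension ℚ 2) (hκ : κ.IsCyclotomic)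
    (n k : ℕ) (hn : 1 ≤ n) (hk : k ≤ 2 ^ n) (hsel : nRankAtLeast (↥(W.selmerLayer κ n)) 2 k) :
    (k : ℕ∞) ≤ mtPairShadow (fun m ↦ C ϖ * mazurTateElement f 2 m) n :=
  (h f W ϖ hf hss hcm hpin hint htam κ hκ n k hn hk).1 hsel

/-- Sanity of the shadow arithmetic on the KO pattern `a = (0, 1, 1, 3)` (basic `a₂ = ±2`): `m_3 = 3`. -/
example : min ((2 ^ 3 : ℕ) : ℕ∞) (min ((3 : ℕ) : ℕ∞) (((2 ^ 2 : ℕ) : ℕ∞) + ((1 : ℕ) : ℕ∞))) = 3 := by decide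

/-- … and on the `a₂ = 0` basic pattern `a = (0, ∞, 1, 5)`: `m_3 = min(8, 5, 4 + 1) = 5`, `m_2 = min(4, 1, 2 + ∞) = 1`. -/
example : min ((2 ^ 3 : ℕ) : ℕ∞) (min ((5 : ℕ) : ℕ∞) (((2 ^ 2 : ℕ) : ℕ∞) + ((1 : ℕ) : ℕ∞))) = 5 ∧
    min ((2 ^ 2 : ℕ) : ℕ∞) (min ((1 : ℕ) : ℕ∞) (((2 ^ 1 : ℕ) : ℕ∞) + (⊤ : ℕ∞))) = 1 := by
  refine ⟨by decide, ?_⟩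
  simp


/-! ## Append (-ty g7, 2026-08-28; CANDIDATES.md row IMC-MTF2♯): the TAMAGAWA SANDWICH — `layerTamagawaTwoVal`, `tamagawaTwoGrowth` (Δ_n),
`@[conjecture] MazurTateFittingSandwichAtTwo` (m_n − Δ_n ≤ min(s_n,2^n) ≤ m_n, NO Tam / NO CM hypothesis), `@[conjecture] MazurTateFittingShadowAtTwoSharp`
(Δ_n = 0 ⇒ equality), plain statement `OddTamagawaStableInTwoTower`, PROVED `mazurTateFittingShadowAtTwoSharp_of_sandwich` / `mazurTateFittingShadowAtTwo_of_sharp`.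
Bodies VERBATIM from -imc g6 `HOME/MEMO-imc-data/dimc17/SketchG6MTF2S-v22.lean` e57a9a9e58b8cfa8 §10.57 addendum (statements byte-identical to the
REF1-audited `SketchG6MTF2S.lean` 88f2da3ce471a685; docstring riders §79 t1/s1/s2 applied by -imc in v21 fb8ffe50da9622ea; -imc asks 07:03:12Z /
07:22:00Z «ONE module»); builder `tools/mk_mtf2s.py`; typer edits = this header, the REF1/REF2 verdict sentences in three docstrings, one tag
normalised (`[folklore] [cite: Silverman1994, …]`). REF1-AUDIT-v1 §79 (2026-08-28T07:10:29Z; evidence `HOME/REF1-data/b79/` Probe_MTF2S.lean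
402e74d6b6e4f4dc rc 0 · 0 sorry · 0 warn; mtf2s_checks.py): SANDWICH / SHARP SURVIVE conjecture-grade, CLEARED as typed; OddTamStable THEOREM-GRADE
(true, tree-hard), CLEARED as plain statement; both theorems correct; chain SANDWICH ⇒ SHARP ⇒(+OddTamStable) STRONG, SANDWICH ⇒ WEAK; BC5 recomputed
independently: D-imc-17 interim 4 080 cells (n = 1,2,3) sandwich **4 080/4 080**, left-half violations 0, right-half (WEAK) 0, SHARP Δ_n = 0 cells EQ
3 024 / NE 0, lower bound attained with Δ_n > 0: 175; OddTamStable 1 885 Tam-odd curves × 3 layers: 0 exceptions; v₂Tam monotone 0/15 327; two Tam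
engines (PARI/Sage) agree 20 436/20 436 (P21). This is the HYPOTHESIS-FORMING sample (README P20); the out-of-sample harvest is -imc's. REF2-PLACEMENT
v18-add1 §7 (d168a909f0ec0cc8 / 97062eb7a51dd4fe, 07:14–07:16Z): SHARP = VARIANT-AT-2 SHARPENED BEYOND PRINT; SANDWICH = NEW-COMBINATION at 2;
OddTamStable folklore; R4 eTNC-compatible in shape only; cite fix Kurihara = Invent. 149 (2002) (`Kurihara2002`). (The §10.58 addendum IMC-MTF2♮
landed as the second append p616216, below.) PARTITION: none moved; beyond-print theorem: no. -/

/-! ## g6 addendum (MEMO-imc §10.57): the TAMAGAWA SANDWICH `IMC-MTF2♯`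

D-imc-17 (kit j301423/j301424, 5 006 + 103 curves, pre-registered P19) killed the no-hypothesis equality
(`O-MTF2♮`): every strict cell sits on a curve whose Tamagawa product acquires new factors of `2` up the tower.
With `Δ_n := v₂(Tam(E/ℚ_n)) − v₂(Tam(E/ℚ))` (D-imc-17c, kit j301789: `elllocalred` over `ℚ_n = ℚ(ζ_{2^{n+2}})⁺`)
the interim table (4 080 cells, n = 1,2,3) satisfies, with ZERO exceptions,
`m_n − Δ_n ≤ min(s_n, 2^n) ≤ m_n`, the lower bound being attained with `Δ_n > 0` in 174 cells; in particular
equality holds whenever `Δ_n = 0` (2 952 non-CM cells, of which 1 176 have `Tam(E/ℚ)` even — beyond the typed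
STRONG form and beyond Kim–Kurihara's printed hypothesis `p ∤ Tam(E)`).
-/

/-- `v₂(Tam(W/ℚ_n))`: the `2`-adic valuation of the Tamagawa product of `W` base-changed to the `n`-th layer
`ℚ_n = κ.layer n` of the `ℤ₂`-extension `κ` (a number field: `finiteDimensional_layer_holds`). -/
def layerTamagawaTwoVal (W : WeierstrassCurve ℚ) (κ : ZpExtension ℚ 2) (n : ℕ) : ℕ :=
  haveI : FiniteDimensional ℚ ↥(κ.layer n) := κ.finiteDimensional_layer_holds n
  haveI : NumberField ↥(κ.layer n) := NumberField.of_module_finite ℚ ↥(κ.layer n)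
  padicValNat 2 (W.baseChange ↥(κ.layer n)).tamagawaProduct

/-- `Δ_n := v₂(Tam(W/ℚ_n)) − v₂(Tam(W/ℚ))`, relative to the BASE `ℚ` (not to layer `n − 1`); truncated `ℕ`-subtraction,
harmless because `c_ℓ ∣ c_w` for `w ∣ ℓ` unramified (`Φ_ℓ(𝔽_ℓ) ⊆ Φ_ℓ(k_w)`) and the number of `w ∣ ℓ` only grows, so the valuation is
non-decreasing up the tower (data: 15 327/15 327 layer steps, REF1 §79 T2; two engines PARI/Sage agree on all 20 436 cells, P21). -/
def tamagawaTwoGrowth (W : WeierstrassCurve ℚ) (κ : ZpExtension ℚ 2) (n : ℕ) : ℕ :=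
  layerTamagawaTwoVal W κ n - padicValNat 2 W.tamagawaProduct

/-- **IMC-MTF2♯ (TAMAGAWA SANDWICH) `MazurTateFittingSandwichAtTwo`** — candidate, conjecture-grade, NO Tamagawa
and NO CM hypothesis. For `W/ℚ` globally minimal, good supersingular at `2`, newform `f`, period pin, `θ_n` `2`-integral:
for every `n ≥ 1` and `k ≤ 2^n`,  `k + Δ_n ≤ m_n ⇒ rk₂ Sel_{2^∞}(W/ℚ_n) ≥ k`  and  `rk₂ Sel_{2^∞}(W/ℚ_n) ≥ k ⇒ k ≤ m_n`;
i.e. `m_n − Δ_n ≤ min(s_n, 2^n) ≤ m_n`. The right half is `MazurTateFittingShadowAtTwoLe`; the left half with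
`Δ_n = 0` is the equality. It is an INEQUALITY only: the exact-deficiency law `m_n − min(s_n,2^n) = min(Δ^Φ_n, room)`
(P20-iv) is refuted on the same sample (317 cells, e.g. `77a1`, `n = 2`), so the slack `Δ_n` is not always used. Print: Kurihara's conjecture carries `p ∤ Tam(E)` (Kim–Kurihara Conj. 1.6) and says nothing
for `p | Tam`; Mazur–Tate 1987 Conj. 3 corrects by local factors at split bad primes; no `𝔽_p`-shadow sandwich located.
REF1-AUDIT §79: SURVIVES conjecture-grade, CLEARED as typed (e1: typed row = README P20-i literally; left half fires in 3 024 Δ_n = 0 cells and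
is ATTAINED with Δ_n > 0 in 175; right half = WEAK verbatim). REF2-PLACEMENT v18-add1 §7: NEW-COMBINATION at 2 (house standard; not new-mechanism)
— shape in print = Kim–Kurihara Thm 1.18, lever = Greenberg 1999 §3 (`|ker r_v| = c_v^{(p)}`); the lower bound as stated (Δ_n, unconditional,
p = 2) is beyond print; R4: not an eTNC-shadow in print-assembly, eTNC-compatible in shape (Burns–Macias Castillo Rem 2.2: the layer Tamagawa
module). Riders §78 r1–r3 of the STRONG row (W(ℚ_n)[2] = 0; KK Conj 1.6 is for ODD p, Rem 1.10; θ-normalisation = −θ^{KO}_{ℚ_n}; `hint`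
discharge) apply verbatim. [cite: KimKurihara2021, Conj. 1.6, Rem. 1.10, Thm. 1.18] [cite: MazurTate1987, Conj. 3] [cite: GreenbergLNM1716, §3 (|ker r_v| = c_v^{(p)})] -/
@[conjecture] def MazurTateFittingSandwichAtTwo : Prop :=
  ∀ {N : ℕ} [NeZero N] (f : CuspForm (Gamma0 N) 2) (W : WeierstrassCurve ℚ) [W.IsElliptic] [W.IsGloballyMinimal]
    (ϖ : ℚ), IsNewformOf W f → GoodSS W 2 →
    (ϖ : ℝ) * W.realPeriodRat = plusPeriod f →
    (∀ n i : ℕ, 0 ≤ padicValRat 2 ((C ϖ * mazurTateElement f 2 n).coeff i)) →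
    ∀ (κ : ZpExtension ℚ 2), κ.IsCyclotomic →
    ∀ n k : ℕ, 1 ≤ n → k ≤ 2 ^ n →
      (((k : ℕ∞) + ((tamagawaTwoGrowth W κ n : ℕ) : ℕ∞) ≤ mtPairShadow (fun m ↦ C ϖ * mazurTateElement f 2 m) n →
          nRankAtLeast (↥(W.selmerLayer κ n)) 2 k) ∧
        (nRankAtLeast (↥(W.selmerLayer κ n)) 2 k →
          (k : ℕ∞) ≤ mtPairShadow (fun m ↦ C ϖ * mazurTateElement f 2 m) n))

/-- **IMC-MTF2♯= `MazurTateFittingShadowAtTwoSharp`** — the equality on the Tamagawa-STABLE locus: if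
`v₂(Tam(W/ℚ_n)) = v₂(Tam(W/ℚ))` then `min(s_n, 2^n) = m_n` (no parity-of-`Tam` and no CM hypothesis).
Interim census: 2 952 + 75 cells, 0 exceptions (REF1 §79 recomputation: Δ_n = 0 cells EQ 3 024 = 2 952 non-CM + 72 CM, NE 0). REF1-AUDIT §79:
SURVIVES conjecture-grade, CLEARED. REF2 v18-add1 §7: VARIANT-AT-2 SHARPENED BEYOND PRINT — on Tam-odd rows it is MTF2; on the 1 176 Tam-EVEN
Δ_n = 0 cells it asserts an equality every printed equality statement excludes by hypothesis (`p ∤ Tam`); no printed counterpart or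
counterexample. [cite: KimKurihara2021, Conj. 1.6, Rem. 1.10] -/
@[conjecture] def MazurTateFittingShadowAtTwoSharp : Prop :=
  ∀ {N : ℕ} [NeZero N] (f : CuspForm (Gamma0 N) 2) (W : WeierstrassCurve ℚ) [W.IsElliptic] [W.IsGloballyMinimal]
    (ϖ : ℚ), IsNewformOf W f → GoodSS W 2 →
    (ϖ : ℝ) * W.realPeriodRat = plusPeriod f →
    (∀ n i : ℕ, 0 ≤ padicValRat 2 ((C ϖ * mazurTateElement f 2 n).coeff i)) →
    ∀ (κ : ZpExtension ℚ 2), κ.IsCyclotomic →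
    ∀ n k : ℕ, 1 ≤ n → k ≤ 2 ^ n → tamagawaTwoGrowth W κ n = 0 →
      (nRankAtLeast (↥(W.selmerLayer κ n)) 2 k ↔
        (k : ℕ∞) ≤ mtPairShadow (fun m ↦ C ϖ * mazurTateElement f 2 m) n)

/-- The Tate-algorithm fact separating the sharp form from the typed STRONG form: an ODD Tamagawa product stays
`2`-adically trivial up the cyclotomic `ℤ₂`-tower of a curve with good reduction at `2` (every `c_v` odd ⇒ Kodaira
type `I_m` (`m` odd, split or non-split), `I₀*` with `c_v = 1`, `IV`, `IV*`, `II`, `II*` ⇒ `c_w ∈ {1, 3, m odd}` over every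
unramified extension of `2`-POWER residue degree (REF1 §79 t1: an `I₀*` prime with `c_v = 1` acquires `c_w = 4` over a residue
extension of degree divisible by `3`, so «every unramified extension» would be false; the typed Prop quantifies over the
`ℤ₂`-tower only, where all residue degrees are powers of `2`); `ℚ_n/ℚ` is unramified at the odd bad primes and `2` is good.
Statement only. ON PAPER routine (Tate's algorithm, Silverman ATAEC IV.9 Table 4.1; data: 1 885 Tam-odd curves × n ≤ 3, 0 exceptions,
REF1 §79 T1/T3); IN THE TREE hard: needs Tate's algorithm over `v.adicCompletion K` (cf. the open named facts
`localTamagawaNumber_ne_zero`, `localTamagawaNumber_eq_one_of_hasGoodReductionAt`). REF1-AUDIT §79: TRUE, THEOREM-GRADE (paper-routine), tree-hard;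
CLEARED as a plain statement; REF2 v18-add1 §7: folklore. [folklore] [cite: Silverman1994, IV.9 (Tate's algorithm, Table 4.1; c-values p. 344–346)] -/
def OddTamagawaStableInTwoTower : Prop :=
  ∀ (W : WeierstrassCurve ℚ) [W.IsElliptic] [W.IsGloballyMinimal] (κ : ZpExtension ℚ 2), κ.IsCyclotomic →
    GoodSS W 2 → Odd W.tamagawaProduct → ∀ n : ℕ, tamagawaTwoGrowth W κ n = 0

/-- SANDWICH ⇒ SHARP (pure logic: `Δ_n = 0`). -/
theorem mazurTateFittingShadowAtTwoSharp_of_sandwich (h : MazurTateFittingSandwichAtTwo) :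
    MazurTateFittingShadowAtTwoSharp := by
  intro N _ f W _ _ ϖ hf hss hpin hint κ hκ n k hn hk hΔ
  obtain ⟨h₁, h₂⟩ := h f W ϖ hf hss hpin hint κ hκ n k hn hk
  refine ⟨h₂, fun hle ↦ h₁ ?_⟩
  simpa [hΔ] using hle

/-- SHARP + the Tate-algorithm fact ⇒ the typed STRONG form `MazurTateFittingShadowAtTwo` (which carries `Tam` odd). -/
theorem mazurTateFittingShadowAtTwo_of_sharp (h : MazurTateFittingShadowAtTwoSharp)
    (hodd : OddTamagawaStableInTwoTower) : MazurTateFittingShadowAtTwo := by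
  intro N _ f W _ _ ϖ hf hss _hcm hpin hint htam κ hκ n k hn hk
  exact h f W ϖ hf hss hpin hint κ hκ n k hn hk (hodd W κ hκ hss htam n)


/-! ## Append (-ty g8, 2026-08-28; CANDIDATES.md row IMC-MTF2♮): NONDEGENERATE-SHADOW EXACTNESS — `@[conjecture] MazurTateFittingShadowAtTwoNondeg`
(`m_n < 2^n` ⇒ `dim Sel₂(W/ℚ_n) = m_n` exactly, `k` untruncated, NO Tam and NO CM hypothesis), `@[conjecture] MazurTateShadowDegenerateBoundAtTwo`
(`m_n = 2^n` ⇒ `rk₂ ≥ 2^n − Δ_n`), PROVED `mtPairShadow_le` and `mazurTateFittingSandwichAtTwo_of_nondeg_of_deg` (NONDEG ∧ DEG ⇒ SANDWICH).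
Bodies VERBATIM from -imc g6 (planner-of-record) ♮-only typing source `HOME/MEMO-imc-data/dimc17/SketchG6MTF2N-v24.lean` ef9d7652fe3ee985 (imports
this tree module, restates nothing; -imc asks 07:32:46Z, 07:48:23Z «second APPEND the moment REF1 clears»; pre-registered P23); builder
`tools/mk_mtf2n.py` (published with the filed text under `HOME/MEMO-ty-data/g8/`); typer edits = this header and REF1 §82's docstring riders n1
(Fitting sentence), n2 (DEG ⟸ SANDWICH), n3 (n = 1 Tam-even degeneracy) — declaration bodies untouched.
REF1-AUDIT-v1 §82 (2026-08-28T08:07:41Z, D-imc-ref1-18; evidence `HOME/REF1-data/b82/`: Probe82.lean 0c893d6f49f2ac12 = this block verbatim on the landed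
module 2c7ec57a3f7190f0 + examples e1–e9, farm rc 0 · 0 err · 0 warn · 0 sorry, axioms {propext, Classical.choice, Quot.sound}; cmpdecls v24 = v23 = v22
SAME 4/4, tree vs v23 SAME 7/7 on the ♯ decls; independent recheck `nondeg_check.py`): **NONDEG SURVIVES conjecture-grade, CLEARED for filing as typed
(k-unbounded iff right and not vacuous, e1, e2); DEG SURVIVES conjecture-grade, CLEARED as typed, IMPLIED by the landed SANDWICH (e8) and kept as its
named degenerate conjunct; the proof `mazurTateFittingSandwichAtTwo_of_nondeg_of_deg` is CORRECT; chain NONDEG ∧ DEG ⇒ SANDWICH ⇒ SHARP ⇒ (+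
`OddTamagawaStableInTwoTower`) STRONG composes BY NAME (e6); the new content of ♮ over ♯ is NONDEG on nondegenerate layers with Δ_n > 0 (430 cells, all
EQ; e9).** BC7 recheck = P23: NONDEG 2 543/2 543 EQ (CM 52 · non-CM Tam-even 1 110, 428 with Δ_n > 0 · Tam-odd 1 381; by n 353 / 936 / 1 254); DEG
1 537 cells, 0 violations (s_n ≥ 2^n on 1 277; below the cap 260, all within 2^n − Δ_n, attained 175, slack 85); m_n from (μ, λ) = prediction column
15 327/15 327. BSD is NOT proved by any of this.
REF2-PLACEMENT v20 §2.1 (D-imc-ref2-18 ANSWERED, register d89a76db5ae2bd61; folded text-only by -ty g8): ♮ = **NOT IN PRINT as keyed, at any p; grade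
NEW-COMBINATION** — lever = Kurihara's Fitting equality for the pair ideal read mod p (KK Conj 1.6 — odd p, E(ℚ)[p] = 0, p ∤ Tam — / Thm 1.8 / KO 2006
Thm 0.1); joined lever = «ONE non-vanishing mod-p shadow determines the structure» (Kim 2022 Thm 1.11, Ota 2018 Thm 1.5: p ≥ 5, p ∤ Tam); delta = p = 2 and
NO Tamagawa/CM hypothesis (the key θ̄_n ≠ 0 does the Tamagawa hypothesis's work, cf. Kim 2022 Rem 4.2/6.2, REF1 §82 n3); a REPAIR PROPOSAL for KK Conj 1.6
at 2 (Rem 1.10 «For the case of p = 2, Conjecture 1.6 may not hold»); beyond-print theorem YES if proved (printed p = 2 corner: KO a₂ = ±2 only); riders t1–t3 = the cites on `…Nondeg` below.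
D-imc-17 FINAL CENSUS (-imc g6 MEMO-imc §10.60, memo e3101983292320d9, 09:36:58Z; kit j301423/j301424 engine A; `MEMO-imc-data/dimc17/final/D17-ROWS.json` bced81da731ee1fc:
5 109 curves, 15 316 decided cells, 11 236 OUT OF SAMPLE; ALL pre-registered kill rules P19/P20/P23/P24 SURVIVED): STRONG-as-typed EQ 5 569 / LT 0 / GT 0; WEAK 15 316/15 316;
SANDWICH 15 316/15 316, SHARP (Δ_n = 0) EQ 10 327/10 327; ♮ NONDEG s_n = m_n on 8 397/8 397 shadow-non-zero cells (OOS 5 854/5 854; Tam-even 4 173, CM 72, Δ_n > 0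
1 746); DEG: degenerate 6 919 = (s_n ≥ 2^n) 5 979 + (below the cap) 940, the latter all with Δ_n > 0 and within 2^n − Δ_n (Δ_n = 0: 0); MISSING 11 cells.
CENSUS / BC5 at filing (-imc §10.58 interim, 4 080 cells): strict cells (260) all have m_n = 2^n; s_n = m_n on all 2 543 cells with m_n < 2^n (+ D-imc-16
242/242) — SUPERSEDED by the FINAL census above (P23 survived out of sample). DATA NOTE (REF1 §82 n3): at n = 1 NONDEG has NO Tam-even content (all 3 205
Tam-even curves have μ(θ_0) ≥ 1, m_1 = 2: consistent with BSD₂ — E(ℚ)[2] = 0 at supersingular 2, so 2 ∣ Tam forces 2 ∣ L(E,1)/Ω ∼ θ_0); the Tam-even test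
is carried by n = 2, 3. KILL RULE (P23): one cell with m_n < 2^n and s_n ≠ m_n (levels agreeing); live falsifier now = a layer-4 engine (P22). WHY NOVEL (-imc §10.58): it isolates the exact locus where the finite-layer Kurihara pair at 2 is an
EQUALITY with no Tamagawa or CM proviso — the non-vanishing of its 𝔽₂-shadow — a dichotomy no printed statement at any p draws. PARTITION: none moved;
beyond-print theorem: no. bears_on: the cell's search question on the SUPERSINGULAR side (finite-layer ± object = the pair (θ_n, ν θ_{n−1})); refines
IMC-MTF2♯; no registered statement item consumes these rows at filing. -/

/-! ## g6 addendum 2 (MEMO-imc §10.58): NONDEGENERATE-SHADOW EXACTNESS `IMC-MTF2♮` (pre-registered P23)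

D-imc-17 interim (1 360 curves, 4 080 cells): EVERY strict cell (`min(s_n,2^n) < m_n`, 260 of them) has `m_n = 2^n`,
i.e. the `𝔽₂`-shadow ideal `(θ̄_n, ν̄ θ̄_{n−1})` is ZERO in `𝔽₂[G_n]` (both `θ_n` and `θ_{n−1}` are divisible by `2`);
on all 2 543 cells with `m_n < 2^n` (shadow non-zero; CM 52, non-CM `Tam` even 1 110 of which 428 have `Δ_n > 0`,
`Tam` odd 1 381) `s_n = m_n` EXACTLY, and on the 103 D-imc-16 curves 242/242. So the Tamagawa defect of the sandwich
is visible only on layers where the shadow carries no information at all.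
-/

/-- **IMC-MTF2♮ (NONDEGENERATE-SHADOW EXACTNESS) `MazurTateFittingShadowAtTwoNondeg`** — candidate, conjecture-grade,
NO Tamagawa and NO CM hypothesis, conclusion UNTRUNCATED: for `W/ℚ` globally minimal, good supersingular at `2`,
newform `f`, period pin, `θ_n` `2`-integral, every `n ≥ 1` with `m_n < 2^n` (the image of the Kurihara pair
`(θ_n, ν_{n−1,n} θ_{n−1})` in `𝔽₂[Gal(ℚ_n/ℚ)] = 𝔽₂[T]/(T^{2^n})` is a NON-ZERO ideal) and every `k`:
`rk₂ Sel_{2^∞}(W/ℚ_n) ≥ k ↔ k ≤ m_n`, i.e. `dim_{𝔽₂} Sel₂(W/ℚ_n) = m_n` on the nose (`W(ℚ_n)[2] = 0` in the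
supersingular-at-`2` tower identifies `Sel₂` with `Sel_{2^∞}[2]`). Pre-registered as P23 before the final D-imc-17 harvest.
Why it might fail: a curve with `Tam` even whose `θ_n` is a `2`-adic unit multiple of a non-trivial shadow while a
Tamagawa class survives in `Sel₂(W/ℚ_n)` outside the Fitting count — none in 2 543 + 242 cells. Print: for ODD `p`
with `p ∤ Tam` Kim–Kurihara prove `Fitt = (θ_n, νθ_{n−1})` under their admissibility hypotheses (Thm 1.14 gives `⊆`
with no Tamagawa hypothesis); no statement keyed to the NON-VANISHING of the mod-`p` shadow located.
In Fitting language (REF1-AUDIT §82 rider n1): over the principal ideal ring `𝔽₂[T]/(T^{2^n})` a module of `𝔽₂`-dimension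
`d < 2^n` has Fitting ideal `(T^d)` (and `0` when `d ≥ 2^n`), so this statement is exactly the mod-`2` image of Kurihara's
equality `Fitt_{Λ_n}(Sel^∨) = (θ_n, ν θ_{n−1})` on the layers where that image is NON-ZERO, with NO `2 ∤ Tam` and NO `¬CM`
hypothesis — which is why the conclusion is untruncated in `k` (REF1 §82 e1, e2: the `∀ k` iff family says `rk₂ = m_n` on the
nose; for `k > 2^n` both sides are false consistently; the unbounded `k` carries precisely the upper bound `rk₂ ≤ m_n` that
the `k ≤ 2^n` window forms STRONG, WEAK, SHARP, SANDWICH cannot express). REF1-AUDIT §82 (2026-08-28T08:07:41Z): SURVIVES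
conjecture-grade, CLEARED for filing as typed; in the corner `a₂ = ±2`, `2 ∤ L/Ω`, `2 ∤ Tam` it is PRINT-derived (Kurihara–Otsuki:
`Sel^∨/2 ≅ 𝔽₂[T]/T^{m_n}`), beyond print outside it. REF2 v20 §2.1: NOT IN PRINT as keyed at any `p`; NEW-COMBINATION; repairs
Kim–Kurihara Conj. 1.6 at `p = 2` on non-degenerate layers (cf. their Rem. 1.10); printed mod-`p`-keyed analogues: Kim 2022 Thm. 1.11, Ota 2018
Thm. 1.5 (both `p ≥ 5`, `p ∤ Tam`); printed `p = 2` corner: Kurihara–Otsuki Thm. 0.1 (`a₂ = ±2` only). [cite: KimKurihara2021, Thm. 1.14, Conj. 1.6, Rem. 1.10]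
[cite: KuriharaOtsuki2006, Thm. 0.1] [cite: Kim2022StructureSelmer, Thm. 1.11, Rem. 4.2] [cite: Ota2018, Thm. 1.5] -/
@[conjecture] def MazurTateFittingShadowAtTwoNondeg : Prop :=
  ∀ {N : ℕ} [NeZero N] (f : CuspForm (Gamma0 N) 2) (W : WeierstrassCurve ℚ) [W.IsElliptic] [W.IsGloballyMinimal]
    (ϖ : ℚ), IsNewformOf W f → GoodSS W 2 →
    (ϖ : ℝ) * W.realPeriodRat = plusPeriod f →
    (∀ n i : ℕ, 0 ≤ padicValRat 2 ((C ϖ * mazurTateElement f 2 n).coeff i)) →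
    ∀ (κ : ZpExtension ℚ 2), κ.IsCyclotomic →
    ∀ n k : ℕ, 1 ≤ n → mtPairShadow (fun m ↦ C ϖ * mazurTateElement f 2 m) n < ((2 ^ n : ℕ) : ℕ∞) →
      (nRankAtLeast (↥(W.selmerLayer κ n)) 2 k ↔
        (k : ℕ∞) ≤ mtPairShadow (fun m ↦ C ϖ * mazurTateElement f 2 m) n)

/-- **IMC-MTF2♮-deg (DEGENERATE-LAYER TAMAGAWA BOUND) `MazurTateShadowDegenerateBoundAtTwo`** — candidate,
conjecture-grade: on a layer `n ≥ 1` where the shadow vanishes (`m_n = 2^n`), `rk₂ Sel_{2^∞}(W/ℚ_n) ≥ 2^n − Δ_n`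
(`Δ_n = tamagawaTwoGrowth`). This is the left half of the sandwich restricted to the degenerate layers; interim census:
1 537 degenerate cells, `s_n ≥ 2^n` on 1 277, `2^n − Δ_n ≤ s_n < 2^n` on 260, 0 exceptions (REF1 §82 recheck: bound ATTAINED on 175,
slack on 85). REF1-AUDIT §82 rider n2 (kernel e8): this statement is IMPLIED by the landed `MazurTateFittingSandwichAtTwo` (its left
half at `k = 2^n − Δ_n`; in the corner `Δ_n ≥ 2^n` the `ℕ`-subtraction truncates to `nRankAtLeast _ 2 0`, true for every group,
e4 — silent, never contradictory) and is kept as the NAMED degenerate conjunct of the decomposition SANDWICH ⟸ NONDEG ∧ DEG; it adds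
no open content beyond IMC-MTF2♯. REF1-AUDIT §82: SURVIVES conjecture-grade, CLEARED as typed. [cite: KimKurihara2021, Thm. 1.18] -/
@[conjecture] def MazurTateShadowDegenerateBoundAtTwo : Prop :=
  ∀ {N : ℕ} [NeZero N] (f : CuspForm (Gamma0 N) 2) (W : WeierstrassCurve ℚ) [W.IsElliptic] [W.IsGloballyMinimal]
    (ϖ : ℚ), IsNewformOf W f → GoodSS W 2 →
    (ϖ : ℝ) * W.realPeriodRat = plusPeriod f →
    (∀ n i : ℕ, 0 ≤ padicValRat 2 ((C ϖ * mazurTateElement f 2 n).coeff i)) →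
    ∀ (κ : ZpExtension ℚ 2), κ.IsCyclotomic →
    ∀ n : ℕ, 1 ≤ n → mtPairShadow (fun m ↦ C ϖ * mazurTateElement f 2 m) n = ((2 ^ n : ℕ) : ℕ∞) →
      nRankAtLeast (↥(W.selmerLayer κ n)) 2 (2 ^ n - tamagawaTwoGrowth W κ n)

/-- The shadow never exceeds the cap `2^n` (it is a `min` with it). -/
theorem mtPairShadow_le (θ : ℕ → ℚ[X]) (n : ℕ) : mtPairShadow θ n ≤ ((2 ^ n : ℕ) : ℕ∞) := by
  unfold mtPairShadow; exact min_le_left _ _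

/-- NONDEG ∧ DEG ⇒ SANDWICH (case split on whether the shadow is the cap). Hence NONDEG ∧ DEG ⇒ SHARP, and with the
Tate-algorithm fact ⇒ the typed STRONG form. -/
theorem mazurTateFittingSandwichAtTwo_of_nondeg_of_deg (h₁ : MazurTateFittingShadowAtTwoNondeg)
    (h₂ : MazurTateShadowDegenerateBoundAtTwo) : MazurTateFittingSandwichAtTwo := by
  intro N _ f W _ _ ϖ hf hss hpin hint κ hκ n k hn hk
  set m := mtPairShadow (fun m ↦ C ϖ * mazurTateElement f 2 m) n with hm
  have hcap : m ≤ ((2 ^ n : ℕ) : ℕ∞) := mtPairShadow_le _ n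
  rcases lt_or_eq_of_le hcap with hlt | heq
  · -- nondegenerate layer: exact law
    have hiff := h₁ f W ϖ hf hss hpin hint κ hκ n k hn hlt
    refine ⟨fun hle ↦ hiff.mpr ?_, fun hrk ↦ hiff.mp hrk⟩
    exact le_trans (by simp) hle
  · -- degenerate layer: Tamagawa bound
    have hrk := h₂ f W ϖ hf hss hpin hint κ hκ n hn heq
    refine ⟨fun hle ↦ ?_, fun _ ↦ by rw [heq]; exact_mod_cast hk⟩
    have hle' : ((k + tamagawaTwoGrowth W κ n : ℕ) : ℕ∞) ≤ ((2 ^ n : ℕ) : ℕ∞) := by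
      rw [← heq]; push_cast; exact hle
    have hle'' : k + tamagawaTwoGrowth W κ n ≤ 2 ^ n := by exact_mod_cast hle'
    exact nRankAtLeast.mono (by omega) hrk

end Summit.BirchSwinnertonDyer.Rank1Residual.F1Sign2

end
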